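import Mathlib.Algebra.Polynomial.AlgebraMap
import Mathlib.Algebra.Polynomial.Degree.Lemmas
import Mathlib.Algebra.Polynomial.Degree.SmallDegree
import Mathlib.RingTheory.MvPolynomial.Homogeneous
import Mathlib.FieldTheory.Perfect
import Mathlib.LinearAlgebra.LinearIndependent.Lemmas
import Mathlib.LinearAlgebra.Dimension.FreeAndStrongRankCondition
import Mathlib.LinearAlgebra.FiniteDimensional.Lemmas
import HarnessLib

/-!
# The Hasse subspace of a form of degree `p` (T29: directional Hasse derivatives, additivity, isotropy)

Uniform value line: INSTRUMENT — a kernel-checked ALGEBRA LEMMA used by engine 1's polynomial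
weighted-centre model `W(f)` of the cell (THEOREM-FS-eng1-g35 §10.4b REMARK (2) "HASSE SUBSPACE";
CARVER-NOTES-eng1-g35 T29; exhaustive `𝔽₅`-check `code/eng1g35/fsp35c.py`) — NOT a resolution
theorem, NOT a statement about the Abramovich–Temkin–Włodarczyk invariant, NOT summit progress;
AI-written Lean, AI review is weaker than expert review. The lemma is independent of the toy model
(it is the elementary differential calculus of Hironaka's additive groups of translations).

## Content (any commutative ring `R`, any index type `σ`; `k` a perfect field for the last part)

For `H ∈ R[x_i : i ∈ σ]` and a direction `v : σ → R`:

* `dirShift v : R[x] →ₐ[R] R[x][T]`, `x_i ↦ x_i + v_i T` (`H ↦ H(x + Tv)`), and the **directional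
  Hasse derivatives** `hasseD v j H :=` the coefficient of `T^j` in `H(x + Tv)`;
  `hasseD_zero` (`D_v^{(0)} = id`), `hasseD_X_pow` (`D_v^{(j)} x_i^n = (n choose j) v_i^j x_i^{n−j}`).
* **Group law and homogeneity of translations**: `reShift_comp_dirShift`
  (`H(x + T(v + w))` is `H(x + Tw)` re-translated by `v`), whence the two-direction Taylor formula
  `hasseD_add : D_{v+w}^{(j)} H = Σ_{l ≤ j} D_v^{(j−l)} D_w^{(l)} H`; `tScale_comp_dirShift` and
  `hasseD_smul : D_{cv}^{(j)} H = c^j D_v^{(j)} H`.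
* **(S1, subspace)** `hasseNull n H : Submodule R (σ → R)` — the vectors `v` with `D_v^{(j)} H = 0`
  for `1 ≤ j < n` — IS a submodule (closure under `+` is `hasseD_add`, under scalars `hasseD_smul`).
* Degree bookkeeping: `hasseD_eq_zero_of_totalDegree_lt` (`D_v^{(j)} H = 0` for `j > deg H`) and,
  for `H` homogeneous of degree `n`, **`hasseD_eq_C_eval : D_v^{(n)} H = H(v)`** (a constant);
  hence `eval_smul_of_isHomogeneous` (`H(cv) = c^n H(v)`) and **(S1, additivity)**
  `eval_add_of_mem_hasseNull : H(v + w) = H(v) + H(w)` for every `v` and `w ∈ hasseNull n H`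
  (`n ≥ 1`), and `hasseD_eq_zero_of_mem_hasseNull_of_eval_eq_zero` (`u ∈ S_n(H)`, `H(u) = 0` ⟹
  `H(x + Tu) = H(x)`).
* **(S2, isotropy; `k` perfect of exponential characteristic `p`, `H` homogeneous of degree `p`)**
  `exists_isotropic_of_linearIndependent`: two linearly independent vectors of `hasseNull p H` span
  a plane containing `u ≠ 0` in `hasseNull p H` with `H(u) = 0` (`u = v − c w`, `c^p = H(v)/H(w)`).
* **(P) ⇒ dim S ≤ 1**: if no `u ≠ 0` has `D_u^{(j)} H = 0` for all `1 ≤ j ≤ p` ("no invariant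
  direction"; for `j = p` the condition is `H(u) = 0`), then `hasseNull p H` contains no linearly
  independent pair (`not_linearIndependent_of_no_invariant_direction`) and
  `finrank_hasseNull_le_one : finrank_k (hasseNull p H) ≤ 1`.

Not here: the dictionary with the multi-index Hasse–Schmidt derivatives `D^{(β)}` of
`HasseSchmidtDerivatives.lean` (`D_v^{(j)} = Σ_{|β| = j} v^β D^{(β)}`) and with
`invarianceSpace` of `HironakaDirectrix.lean` (kept Mathlib-only on purpose).

References (context; the statements are elementary and proved here): [Hironaka1970AdditiveGroups]
(the additive group of translations `v` with `f(x + v) = f(x)` of a homogeneous ideal, cut out by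
differential operators); [Giraud1975] §1.6 (additive forms over a perfect field are `p`-th powers
of linear forms — the mechanism of (S2)); [BerthomieuHivertMourtada2010] Cor. 2.3 (the ridge of a
form via its Hasse–Schmidt derivatives).
-/

open MvPolynomial

namespace Literature.AlgebraicGeometry.Resolution.WeightedBlowup

namespace HasseDir

section CommRing

variable {σ : Type*} {R : Type*} [CommRing R]

/-! ### Translation along a direction and directional Hasse derivatives -/

/-- The linear factor `x_i + v_i T ∈ R[x][T]`. [cite: Hironaka1970AdditiveGroups, §1] -/
noncomputable def linFactor (v : σ → R) (i : σ) : Polynomial (MvPolynomial σ R) :=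
  Polynomial.C (X i) + Polynomial.C (C (v i)) * Polynomial.X

/-- **`H ↦ H(x + Tv)`**: the `R`-algebra map `R[x] → R[x][T]`, `x_i ↦ x_i + v_i T`.
[cite: Hironaka1970AdditiveGroups, §1] -/
noncomputable def dirShift (v : σ → R) : MvPolynomial σ R →ₐ[R] Polynomial (MvPolynomial σ R) :=
  aeval (linFactor v)

/-- [cite: Hironaka1970AdditiveGroups, §1] -/
@[simp] theorem dirShift_X (v : σ → R) (i : σ) :
    dirShift v (X i) = Polynomial.C (X i) + Polynomial.C (C (v i)) * Polynomial.X := by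
  rw [dirShift, aeval_X]; rfl

/-- [cite: Hironaka1970AdditiveGroups, §1] -/
@[simp] theorem dirShift_C (v : σ → R) (a : R) : dirShift v (C a) = Polynomial.C (C a) := by
  rw [dirShift, aeval_C, Polynomial.algebraMap_apply, MvPolynomial.algebraMap_eq]

/-- **Directional Hasse derivative** `D_v^{(j)} H :=` the coefficient of `T^j` in `H(x + Tv)`.
[cite: Hironaka1970AdditiveGroups, §1] -/
noncomputable def hasseD (v : σ → R) (j : ℕ) (H : MvPolynomial σ R) : MvPolynomial σ R :=
  (dirShift v H).coeff j

/-- (derived here) [cite: Hironaka1970AdditiveGroups, §1] -/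
theorem hasseD_def (v : σ → R) (j : ℕ) (H : MvPolynomial σ R) :
    hasseD v j H = (dirShift v H).coeff j := rfl

/-- `D_v^{(j)}` is additive in `H`. (derived here) [cite: Hironaka1970AdditiveGroups, §1] -/
theorem hasseD_add_right (v : σ → R) (j : ℕ) (H₁ H₂ : MvPolynomial σ R) :
    hasseD v j (H₁ + H₂) = hasseD v j H₁ + hasseD v j H₂ := by
  simp [hasseD]

/-- (derived here) [cite: Hironaka1970AdditiveGroups, §1] -/
@[simp] theorem hasseD_zero_right (v : σ → R) (j : ℕ) : hasseD v j (0 : MvPolynomial σ R) = 0 := by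
  simp [hasseD]

/-- `D_v^{(0)} H = H` (set `T = 0`). (derived here) [cite: Hironaka1970AdditiveGroups, §1] -/
theorem hasseD_zero (v : σ → R) (H : MvPolynomial σ R) : hasseD v 0 H = H := by
  have key : ((Polynomial.aeval (R := MvPolynomial σ R) (0 : MvPolynomial σ R)).restrictScalars R).comp
      (dirShift v) = AlgHom.id R (MvPolynomial σ R) := by
    refine MvPolynomial.algHom_ext fun i => ?_
    simp [dirShift_X]
  have h := congrArg (fun φ : MvPolynomial σ R →ₐ[R] MvPolynomial σ R => φ H) key
  simp only [AlgHom.comp_apply, AlgHom.restrictScalars_apply, AlgHom.id_apply,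
    Polynomial.coe_aeval_eq_eval] at h
  rw [hasseD, Polynomial.coeff_zero_eq_eval_zero]
  exact h

/-- **Binomial values**: `D_v^{(j)} (x_i^n) = (n choose j) v_i^j x_i^{n−j}` (EGA's
`D_j(z^n) = (n choose j) z^{n−j}` along `v`). (derived here) [cite: Hironaka1970AdditiveGroups, §1] -/
theorem hasseD_X_pow (v : σ → R) (i : σ) (n j : ℕ) :
    hasseD v j (X i ^ n) = C ((n.choose j : R) * v i ^ j) * X i ^ (n - j) := by
  rw [hasseD, map_pow, dirShift_X, add_pow, Polynomial.finsetSum_coeff]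
  have hterm : ∀ m, (Polynomial.C (X i) ^ m * (Polynomial.C (C (v i)) * Polynomial.X) ^ (n - m) *
      (n.choose m : Polynomial (MvPolynomial σ R))).coeff j =
        if j = n - m then X i ^ m * C (v i) ^ (n - m) * (n.choose m : MvPolynomial σ R) else 0 := by
    intro m
    rw [mul_pow, ← map_pow, ← map_pow, ← map_natCast Polynomial.C, Polynomial.coeff_mul_C,
      Polynomial.coeff_C_mul, Polynomial.coeff_C_mul_X_pow]
    split_ifs <;> simp
  simp_rw [hterm]
  rw [Finset.sum_eq_single (n - j)]
  · by_cases hj : j ≤ n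
    · rw [if_pos (by omega), Nat.sub_sub_self hj, Nat.choose_symm hj, map_mul, map_natCast, map_pow]
      ring
    · rw [if_neg (by omega), Nat.choose_eq_zero_of_lt (by omega), Nat.cast_zero, zero_mul, map_zero,
        zero_mul]
  · intro m hm hne
    rw [Finset.mem_range] at hm
    exact if_neg (by omega)
  · intro h
    exact absurd (Finset.mem_range.mpr (by omega)) h

/-! ### The group law: two-direction Taylor formula -/

/-- Re-translation by `v` of a polynomial of `R[x][T]`: `Σ a_l(x) T^l ↦ Σ a_l(x + Tv) T^l`.
[cite: Hironaka1970AdditiveGroups, §1] -/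
noncomputable def reShift (v : σ → R) :
    Polynomial (MvPolynomial σ R) →ₐ[R] Polynomial (MvPolynomial σ R) :=
  Polynomial.aevalTower (dirShift v) Polynomial.X

/-- [cite: Hironaka1970AdditiveGroups, §1] -/
@[simp] theorem reShift_C (v : σ → R) (a : MvPolynomial σ R) :
    reShift v (Polynomial.C a) = dirShift v a :=
  Polynomial.aevalTower_C _ _ _

/-- [cite: Hironaka1970AdditiveGroups, §1] -/
@[simp] theorem reShift_X (v : σ → R) : reShift v (Polynomial.X) = Polynomial.X :=
  Polynomial.aevalTower_X _ _

/-- **Group law of translations**: `H(x + T(v + w)) = (H(· + Tw))(x + Tv)`.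
(derived here) [cite: Hironaka1970AdditiveGroups, §1] -/
theorem reShift_comp_dirShift (v w : σ → R) :
    (reShift v).comp (dirShift w) = dirShift (v + w) := by
  refine MvPolynomial.algHom_ext fun i => ?_
  simp only [AlgHom.comp_apply, dirShift_X, map_add, map_mul, reShift_C, reShift_X, dirShift_C,
    Pi.add_apply]
  ring

/-- (derived here) [cite: Hironaka1970AdditiveGroups, §1] -/
theorem dirShift_add_apply (v w : σ → R) (H : MvPolynomial σ R) :
    dirShift (v + w) H = reShift v (dirShift w H) := by
  rw [← reShift_comp_dirShift]; rfl

/-- (derived here) [cite: Hironaka1970AdditiveGroups, §1] -/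
theorem reShift_apply_eq_sum (v : σ → R) (q : Polynomial (MvPolynomial σ R)) :
    reShift v q = ∑ e ∈ q.support, dirShift v (q.coeff e) * Polynomial.X ^ e := by
  conv_lhs => rw [q.as_sum_support_C_mul_X_pow]
  simp only [map_sum, map_mul, map_pow, reShift_C, reShift_X]

/-- **Two-direction Taylor formula**: `D_{v+w}^{(j)} H = Σ_{l ≤ j} D_v^{(j−l)} (D_w^{(l)} H)`.
(derived here) [cite: Hironaka1970AdditiveGroups, §1] -/
theorem hasseD_add (v w : σ → R) (j : ℕ) (H : MvPolynomial σ R) :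
    hasseD (v + w) j H = ∑ l ∈ Finset.range (j + 1), hasseD v (j - l) (hasseD w l H) := by
  classical
  simp only [hasseD]
  rw [dirShift_add_apply, reShift_apply_eq_sum, Polynomial.finsetSum_coeff]
  set q := dirShift w H with hq
  have hterm : ∀ e, (dirShift v (q.coeff e) * Polynomial.X ^ e).coeff j =
      if e ≤ j then (dirShift v (q.coeff e)).coeff (j - e) else 0 := fun e =>
    Polynomial.coeff_mul_X_pow' _ _ _
  simp_rw [hterm]
  have h1 : ∑ e ∈ q.support, (if e ≤ j then (dirShift v (q.coeff e)).coeff (j - e) else 0) =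
      ∑ e ∈ q.support ∪ Finset.range (j + 1),
        (if e ≤ j then (dirShift v (q.coeff e)).coeff (j - e) else 0) := by
    refine Finset.sum_subset Finset.subset_union_left fun e _ he => ?_
    have hc : q.coeff e = 0 := by simpa [Polynomial.mem_support_iff] using he
    simp [hc]
  have h2 : ∑ e ∈ Finset.range (j + 1), (if e ≤ j then (dirShift v (q.coeff e)).coeff (j - e) else 0) =
      ∑ e ∈ q.support ∪ Finset.range (j + 1),
        (if e ≤ j then (dirShift v (q.coeff e)).coeff (j - e) else 0) := by
    refine Finset.sum_subset Finset.subset_union_right fun e _ he => ?_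
    rw [Finset.mem_range, Nat.lt_succ_iff] at he
    exact if_neg he
  have h3 : ∑ l ∈ Finset.range (j + 1), (dirShift v (q.coeff l)).coeff (j - l) =
      ∑ e ∈ Finset.range (j + 1), (if e ≤ j then (dirShift v (q.coeff e)).coeff (j - e) else 0) := by
    refine Finset.sum_congr rfl fun l hl => ?_
    rw [if_pos (Nat.lt_succ_iff.mp (Finset.mem_range.mp hl))]
  rw [h1, h3, h2]

/-! ### Homogeneity of translations in the direction -/

/-- The scaling `T ↦ cT` of `R[x][T]`. [cite: Hironaka1970AdditiveGroups, §1] -/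
noncomputable def tScale (c : R) : Polynomial (MvPolynomial σ R) →ₐ[R] Polynomial (MvPolynomial σ R) :=
  (Polynomial.aeval (R := MvPolynomial σ R) (Polynomial.C (C c) * Polynomial.X)).restrictScalars R

/-- `H(x + T(cv)) = H(x + (cT)v)`. (derived here) [cite: Hironaka1970AdditiveGroups, §1] -/
theorem tScale_comp_dirShift (c : R) (v : σ → R) :
    (tScale c).comp (dirShift v) = dirShift (c • v) := by
  refine MvPolynomial.algHom_ext fun i => ?_
  simp only [AlgHom.comp_apply, dirShift_X, tScale, AlgHom.restrictScalars_apply, map_add, map_mul,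
    Polynomial.aeval_C, Polynomial.aeval_X, Polynomial.algebraMap_eq, Pi.smul_apply, smul_eq_mul]
  ring

/-- Coefficients of `q(cT)`: `coeff_j q(cT) = c^j coeff_j q`. (derived here) [cite: Hironaka1970AdditiveGroups, §1] -/
theorem coeff_aeval_C_mul_X {A : Type*} [CommSemiring A] (a : A) (q : Polynomial A) (j : ℕ) :
    (Polynomial.aeval (Polynomial.C a * Polynomial.X) q).coeff j = a ^ j * q.coeff j := by
  rw [Polynomial.aeval_eq_sum_range, Polynomial.finsetSum_coeff]
  have hterm : ∀ i, (q.coeff i • (Polynomial.C a * Polynomial.X) ^ i).coeff j =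
      if j = i then q.coeff i * a ^ i else 0 := by
    intro i
    rw [mul_pow, ← map_pow, Polynomial.smul_eq_C_mul, ← mul_assoc, ← map_mul,
      Polynomial.coeff_C_mul_X_pow]
  simp_rw [hterm]
  rw [Finset.sum_ite_eq]
  split_ifs with h
  · exact mul_comm _ _
  · rw [Finset.mem_range, not_lt] at h
    rw [Polynomial.coeff_eq_zero_of_natDegree_lt (by omega), mul_zero]

/-- **Homogeneity**: `D_{cv}^{(j)} H = c^j D_v^{(j)} H`. (derived here) [cite: Hironaka1970AdditiveGroups, §1] -/
theorem hasseD_smul (c : R) (v : σ → R) (j : ℕ) (H : MvPolynomial σ R) :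
    hasseD (c • v) j H = c ^ j • hasseD v j H := by
  have h := congrArg (fun φ : MvPolynomial σ R →ₐ[R] Polynomial (MvPolynomial σ R) => φ H)
    (tScale_comp_dirShift c v)
  simp only [AlgHom.comp_apply] at h
  rw [hasseD, ← h, tScale, AlgHom.restrictScalars_apply, coeff_aeval_C_mul_X, hasseD,
    MvPolynomial.smul_eq_C_mul, map_pow]

/-! ### (S1) The Hasse null space is a submodule -/

/-- **The Hasse null space** `S_n(H) = {v | D_v^{(j)} H = 0 for 1 ≤ j < n}` as an `R`-submodule of
`R^σ` (for a form of degree `p` in characteristic `p` take `n = p`).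
[cite: Hironaka1970AdditiveGroups, §1–2] -/
noncomputable def hasseNull (n : ℕ) (H : MvPolynomial σ R) : Submodule R (σ → R) where
  carrier := {v | ∀ j, 1 ≤ j → j < n → hasseD v j H = 0}
  add_mem' {v w} hv hw := by
    simp only [Set.mem_setOf_eq] at hv hw ⊢
    intro j hj1 hjn
    rw [hasseD_add]
    refine Finset.sum_eq_zero fun l hl => ?_
    rcases Nat.eq_zero_or_pos l with rfl | hl0
    · rw [hasseD_zero, Nat.sub_zero]; exact hv j hj1 hjn
    · have hlj : l ≤ j := Nat.lt_succ_iff.mp (Finset.mem_range.mp hl)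
      rw [hw l hl0 (lt_of_le_of_lt hlj hjn), hasseD_zero_right]
  zero_mem' := by
    simp only [Set.mem_setOf_eq]
    intro j hj1 _
    have h := hasseD_smul (0 : R) (0 : σ → R) j H
    rwa [smul_zero, zero_pow (by omega), zero_smul] at h
  smul_mem' c {v} hv := by
    simp only [Set.mem_setOf_eq] at hv ⊢
    intro j hj1 hjn
    rw [hasseD_smul, hv j hj1 hjn, smul_zero]

/-- (derived here) [cite: Hironaka1970AdditiveGroups, §1–2] -/
theorem mem_hasseNull {n : ℕ} {H : MvPolynomial σ R} {v : σ → R} :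
    v ∈ hasseNull n H ↔ ∀ j, 1 ≤ j → j < n → hasseD v j H = 0 := Iff.rfl

/-! ### Degree bookkeeping: `D_v^{(j)} H = 0` for `j > deg H`, `D_v^{(deg)} H = H(v)` for forms -/

/-- (derived here) [cite: Hironaka1970AdditiveGroups, §1] -/
theorem natDegree_linFactor_le (v : σ → R) (i : σ) : (linFactor v i).natDegree ≤ 1 := by
  unfold linFactor
  rw [add_comm]
  exact Polynomial.natDegree_linear_le

/-- (derived here) [cite: Hironaka1970AdditiveGroups, §1] -/
theorem coeff_linFactor_one (v : σ → R) (i : σ) : (linFactor v i).coeff 1 = C (v i) := by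
  simp [linFactor, Polynomial.coeff_C]

/-- The product `Π_i (x_i + v_i T)^{m_i}` has `T`-degree `≤ |m|` and `T^{|m|}`-coefficient `v^m`.
(derived here) [cite: Hironaka1970AdditiveGroups, §1] -/
theorem prod_linFactor_pow (v : σ → R) (m : σ →₀ ℕ) :
    (m.prod fun i e => linFactor v i ^ e).natDegree ≤ m.degree ∧
      (m.prod fun i e => linFactor v i ^ e).coeff m.degree = C (m.prod fun i e => v i ^ e) := by
  induction m using Finsupp.induction with
  | zero => simp
  | single_add i e m hi he ih =>
    obtain ⟨ih1, ih2⟩ := ih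
    have hsplit : ((Finsupp.single i e + m).prod fun i e => linFactor v i ^ e) =
        linFactor v i ^ e * m.prod fun i e => linFactor v i ^ e := by
      rw [Finsupp.prod_add_index' (fun _ => pow_zero _) (fun _ _ _ => pow_add _ _ _),
        Finsupp.prod_single_index (h := fun i e => linFactor v i ^ e) (pow_zero _)]
    have hsplit' : ((Finsupp.single i e + m).prod fun i e => v i ^ e) =
        v i ^ e * m.prod fun i e => v i ^ e := by
      rw [Finsupp.prod_add_index' (fun _ => pow_zero _) (fun _ _ _ => pow_add _ _ _),
        Finsupp.prod_single_index (h := fun i e => v i ^ e) (pow_zero _)]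
    have hdeg : (Finsupp.single i e + m).degree = e + m.degree := by
      rw [map_add, Finsupp.degree_single]
    have hL := natDegree_linFactor_le v i
    have hpow : (linFactor v i ^ e).natDegree ≤ e := by
      simpa using Polynomial.natDegree_pow_le_of_le e hL
    rw [hsplit, hsplit', hdeg]
    refine ⟨Polynomial.natDegree_mul_le.trans (add_le_add hpow ih1), ?_⟩
    rw [Polynomial.coeff_mul_add_eq_of_natDegree_le hpow ih1, ih2, map_mul, map_pow,
      ← coeff_linFactor_one v i]
    congr 1
    simpa using Polynomial.coeff_pow_of_natDegree_le (m := e) hL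

/-- (derived here) [cite: Hironaka1970AdditiveGroups, §1] -/
theorem dirShift_monomial (v : σ → R) (m : σ →₀ ℕ) (a : R) :
    dirShift v (monomial m a) = Polynomial.C (C a) * m.prod fun i e => linFactor v i ^ e := by
  rw [dirShift, aeval_monomial, Polynomial.algebraMap_apply, MvPolynomial.algebraMap_eq]

/-- (derived here) [cite: Hironaka1970AdditiveGroups, §1] -/
theorem natDegree_dirShift_monomial_le (v : σ → R) (m : σ →₀ ℕ) (a : R) :
    (dirShift v (monomial m a)).natDegree ≤ m.degree := by
  rw [dirShift_monomial]
  exact (Polynomial.natDegree_C_mul_le _ _).trans (prod_linFactor_pow v m).1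

/-- `D_v^{(|m|)} (a x^m) = a v^m`. (derived here) [cite: Hironaka1970AdditiveGroups, §1] -/
theorem hasseD_monomial_degree (v : σ → R) (m : σ →₀ ℕ) (a : R) :
    hasseD v m.degree (monomial m a) = C (a * m.prod fun i e => v i ^ e) := by
  rw [hasseD, dirShift_monomial, Polynomial.coeff_C_mul, (prod_linFactor_pow v m).2, ← map_mul]

/-- `H(x + Tv)` has `T`-degree at most `deg H`. (derived here) [cite: Hironaka1970AdditiveGroups, §1] -/
theorem natDegree_dirShift_le (v : σ → R) (H : MvPolynomial σ R) :
    (dirShift v H).natDegree ≤ H.totalDegree := by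
  classical
  conv_lhs => rw [H.as_sum]
  rw [map_sum]
  refine Polynomial.natDegree_sum_le_of_forall_le _ _ fun m hm => ?_
  refine (natDegree_dirShift_monomial_le v m _).trans ?_
  rw [Finsupp.degree_apply]
  exact le_totalDegree hm

/-- `D_v^{(j)} H = 0` for `j > deg H`. (derived here) [cite: Hironaka1970AdditiveGroups, §1] -/
theorem hasseD_eq_zero_of_totalDegree_lt (v : σ → R) {j : ℕ} (H : MvPolynomial σ R)
    (hj : H.totalDegree < j) : hasseD v j H = 0 :=
  Polynomial.coeff_eq_zero_of_natDegree_lt ((natDegree_dirShift_le v H).trans_lt hj)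

/-- **Top Hasse derivative of a form**: for `H` homogeneous of degree `n`, `D_v^{(n)} H = H(v)`
(a constant polynomial). (derived here) [cite: Hironaka1970AdditiveGroups, §1–2] -/
theorem hasseD_eq_C_eval (v : σ → R) {n : ℕ} {H : MvPolynomial σ R} (hH : H.IsHomogeneous n) :
    hasseD v n H = C (eval v H) := by
  classical
  conv_lhs => rw [H.as_sum]
  rw [hasseD, map_sum, Polynomial.finsetSum_coeff, MvPolynomial.eval_eq, map_sum]
  refine Finset.sum_congr rfl fun m hm => ?_
  have hdeg : m.degree = n := by
    by_contra hd
    exact (mem_support_iff.mp hm) (hH.coeff_eq_zero hd)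
  rw [← hdeg, ← hasseD_def, hasseD_monomial_degree]
  rfl

/-- **Homogeneity of evaluation**: `H(cv) = c^n H(v)` for a form of degree `n`.
(derived here) [cite: Hironaka1970AdditiveGroups, §1–2] -/
theorem eval_smul_of_isHomogeneous {n : ℕ} {H : MvPolynomial σ R} (hH : H.IsHomogeneous n)
    (c : R) (v : σ → R) : eval (c • v) H = c ^ n * eval v H := by
  have h := hasseD_smul c v n H
  rw [hasseD_eq_C_eval _ hH, hasseD_eq_C_eval _ hH, MvPolynomial.smul_eq_C_mul, ← map_mul] at h
  exact C_injective σ R h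

/-- **(S1, additivity)**: translation by a vector `w` of the Hasse null space changes a form `H`
of degree `n ≥ 1` by the constant `H(w)`: `H(v + w) = H(v) + H(w)` for EVERY `v` and `w ∈ S_n(H)`
(in particular `H` is additive on `S_n(H)`). (derived here) [cite: Hironaka1970AdditiveGroups, §1–2] -/
theorem eval_add_of_mem_hasseNull {n : ℕ} {H : MvPolynomial σ R} (hH : H.IsHomogeneous n)
    (hn : 1 ≤ n) (v : σ → R) {w : σ → R} (hw : w ∈ hasseNull n H) :
    eval (v + w) H = eval v H + eval w H := by
  have h := hasseD_add v w n H
  rw [hasseD_eq_C_eval _ hH, Finset.sum_range_succ, Nat.sub_self, hasseD_zero,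
    hasseD_eq_C_eval _ hH] at h
  have hmid : ∑ l ∈ Finset.range n, hasseD v (n - l) (hasseD w l H) = C (eval v H) := by
    rw [Finset.sum_eq_single 0, Nat.sub_zero, hasseD_zero, hasseD_eq_C_eval _ hH]
    · intro l hl hl0
      rw [(mem_hasseNull.mp hw) l (Nat.pos_of_ne_zero hl0) (Finset.mem_range.mp hl),
        hasseD_zero_right]
    · intro h0
      exact absurd (Finset.mem_range.mpr hn) h0
  rw [hmid, ← map_add] at h
  exact C_injective σ R h

/-- For a form of degree `n` and `u ∈ S_n(H)` with `H(u) = 0`, the translation by `u` leaves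
`H` invariant: `H(x + Tu) = H(x)`, i.e. every `D_u^{(j)} H`, `j ≥ 1`, vanishes.
(derived here) [cite: Hironaka1970AdditiveGroups, §1–2] -/
theorem hasseD_eq_zero_of_mem_hasseNull_of_eval_eq_zero {n : ℕ} {H : MvPolynomial σ R}
    (hH : H.IsHomogeneous n) {u : σ → R} (hu : u ∈ hasseNull n H) (hHu : eval u H = 0)
    {j : ℕ} (hj : 1 ≤ j) : hasseD u j H = 0 := by
  rcases lt_trichotomy j n with hlt | rfl | hgt
  · exact (mem_hasseNull.mp hu) j hj hlt
  · rw [hasseD_eq_C_eval u hH, hHu, map_zero]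
  · exact hasseD_eq_zero_of_totalDegree_lt u H (hH.totalDegree_le.trans_lt hgt)

end CommRing

/-! ### (S2) Isotropy over a perfect field and `(P) ⇒ dim S ≤ 1` -/

section Perfect

variable {σ : Type*} {k : Type*} [Field k] (p : ℕ) [ExpChar k p] [PerfectRing k p]

/-- **(S2)**: `k` perfect of exponential characteristic `p`, `H` a form of degree `p`. Two linearly
independent vectors `v, w` of the Hasse null space `S_p(H)` yield `u ∈ S_p(H)`, `u ≠ 0`, with
`H(u) = 0`: `u = w` if `H(w) = 0`, else `u = v − c w` with `c = (H(v)/H(w))^{1/p}` (additivity on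
`S_p(H)` and `H(cw) = c^p H(w)`). (derived here) [cite: Giraud1975, §1.6] -/
theorem exists_isotropic_of_linearIndependent {H : MvPolynomial σ k} (hH : H.IsHomogeneous p)
    {v w : σ → k} (hv : v ∈ hasseNull p H) (hw : w ∈ hasseNull p H)
    (hvw : LinearIndependent k ![v, w]) :
    ∃ u ∈ hasseNull p H, u ≠ 0 ∧ eval u H = 0 := by
  have hp1 : 1 ≤ p := expChar_pos k p
  by_cases hw0 : eval w H = 0
  · refine ⟨w, hw, ?_, hw0⟩
    simpa using hvw.ne_zero 1
  · set c := (frobeniusEquiv k p).symm (eval v H / eval w H) with hc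
    have hcp : c ^ p = eval v H / eval w H := frobeniusEquiv_symm_pow_p k p _
    refine ⟨v + (-c) • w, add_mem hv (Submodule.smul_mem _ (-c) hw), ?_, ?_⟩
    · intro h0
      have h := (LinearIndependent.pair_iff.mp hvw) 1 (-c) (by rw [one_smul, h0])
      exact one_ne_zero h.1
    · have hneg : (-c) ^ p = -(c ^ p) := by
        rw [neg_pow, neg_one_pow_expChar k p, neg_one_mul]
      rw [eval_add_of_mem_hasseNull hH hp1 v (Submodule.smul_mem _ (-c) hw),
        eval_smul_of_isHomogeneous hH, hneg, hcp, neg_mul, div_mul_cancel₀ _ hw0, add_neg_cancel]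

/-- **(P) ⇒ no independent pair in `S_p(H)`**: if `H` (a form of degree `p`) has NO INVARIANT
DIRECTION — no `u ≠ 0` with `D_u^{(j)} H = 0` for all `1 ≤ j ≤ p` — then its Hasse null space
contains no two linearly independent vectors. (derived here) [cite: Giraud1975, §1.6] -/
theorem not_linearIndependent_of_no_invariant_direction {H : MvPolynomial σ k}
    (hH : H.IsHomogeneous p)
    (hP : ∀ u : σ → k, u ≠ 0 → ∃ j, 1 ≤ j ∧ j ≤ p ∧ hasseD u j H ≠ 0)
    {v w : σ → k} (hv : v ∈ hasseNull p H) (hw : w ∈ hasseNull p H) :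
    ¬ LinearIndependent k ![v, w] := by
  intro hvw
  obtain ⟨u, hu, hu0, hHu⟩ := exists_isotropic_of_linearIndependent p hH hv hw hvw
  obtain ⟨j, hj1, hjp, hj⟩ := hP u hu0
  exact hj (hasseD_eq_zero_of_mem_hasseNull_of_eval_eq_zero hH hu hHu hj1)

/-- **(P) ⇒ `dim S_p(H) ≤ 1`** (finitely many variables). (derived here) [cite: Giraud1975, §1.6] -/
theorem finrank_hasseNull_le_one [Finite σ] {H : MvPolynomial σ k} (hH : H.IsHomogeneous p)
    (hP : ∀ u : σ → k, u ≠ 0 → ∃ j, 1 ≤ j ∧ j ≤ p ∧ hasseD u j H ≠ 0) :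
    Module.finrank k (hasseNull p H) ≤ 1 := by
  rw [finrank_le_one_iff]
  by_cases h0 : ∃ v ∈ hasseNull p H, v ≠ 0
  · obtain ⟨v, hv, hv0⟩ := h0
    refine ⟨⟨v, hv⟩, fun w => ?_⟩
    have hdep := not_linearIndependent_of_no_invariant_direction p hH hP hv w.2
    rw [LinearIndependent.pair_iff' hv0, not_forall] at hdep
    obtain ⟨a, ha⟩ := hdep
    rw [not_not] at ha
    exact ⟨a, Subtype.ext (by simpa using ha)⟩
  · simp only [not_exists, not_and, not_not] at h0
    refine ⟨0, fun w => ⟨0, ?_⟩⟩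
    have hw0 : w = 0 := Subtype.ext (h0 w.1 w.2)
    rw [hw0, smul_zero]

end Perfect

end HasseDir

end Literature.AlgebraicGeometry.Resolution.WeightedBlowup
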